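import Summits.QuantumFields.YangMills.Theorems.BalabanUVNodesN19TiltedPrice
import Summits.QuantumFields.YangMills.Theorems.BalabanUVNodesN19OffWindowPriceTwoSided
import Summits.QuantumFields.YangMills.Theorems.BalabanUVNodesN19SharpPriceTwoSided

/-!
# YM-DAG node N19 (= NE7 proper) — THE TILTED PRICE, module 3∕3: the edge price `ε·(log ε⁻¹∕log log ε⁻¹)²` is ATTAINED — the grid-Chebyshev pair
# of p510514 read AT THE EDGE of the window (`T_M′(1) = M²`, Markov's extremal), two-sided

Cell `pub-ymgap`, HUMAN RULING D-0062 (Track A), R141 (C) wider-strategy seat `pub-ymgap-dag-n19-e` (strategy s3 = ALTERNATIVE CURRENCY), generation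
g15, module 3 of 3 (siblings: `…N19TiltedPriceGauges`, `…N19TiltedPrice` — the upper bounds).  Route `Summits/QuantumFields/YangMills/Theses/BalabanUVNodes.lean`
rev 21, cluster item K3⁵ «SpineGivenEndpointR13SepCoP» (stmt-QuantumFields-20296); filed `--supports` that item `--as helper` (it proves no registered stub).
COUNT-NEUTRAL: elementary, over Mathlib (`Polynomial.Chebyshev.T_derivative_eq_U`, `U_eval_one`, `Measure.tilted`) and the seat's modules BY NAME —
p509390 `…N19NoLinearPriceWitness` (the transported Chebyshev polynomial `P_M = T_M ∘ ((u−1)∕r)`), p510514 `…N19NoLinearPrice` (`expsum_eq_eval`,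
`exists_lawPair_of_weights`, …), p517472 (`one_add_le_mul_log_of_le`), p524926 (`mgf_le_exp_of_Icc`), `…N19TiltedPrice` (the upper half); NOT a discharge claim.

WHAT IT SAYS.  `…N19TiltedPrice` bounds the tilted-mean difference of two `[−B, B]`-bounded observables with cgf's `ε`-close on `|u| ≤ l₀` by
Markov's `≍ ε·n²∕l₀`, `n = log ε⁻¹∕log log ε⁻¹`, up to the edge `|s| = l₀`.  HERE: AT the edge this order is attained, by the SAME signed grid measure
that made the centre price (p517472) and the off-window price (p524926) sharp: `w_j = (2∕Λ)·[uʲ]P_M`, `r = e^{l₀∕M} − 1`, `ε = 2∕Λ`,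
`Σ_j w_j e^{tj∕M} = ε·P_M(e^{t∕M})` (`≤ ε` on the window, `= ε` at `t = l₀`), and the `t`-DERIVATIVE at the edge is
`Σ_j w_j (j∕M) e^{l₀j∕M} = (ε∕M)·(1+r)·P_M′(1+r) = ε·M·(1+r)∕r ≥ ε·M²∕l₀` (§1: `P_M′(1+r) = T_M′(1)∕r = M²∕r`, Markov's extremal; `(1+r)∕r ≥ M∕l₀`) —
§2 ★ `exists_expsum_witness_edge`.  §3: as two probability laws on `[0, 1]` the partition functions at tilt `l₀` differ by EXACTLY `ε`, the tilted
first moments by `≥ ε·M²∕l₀` ⇒ ★ `exists_cgf_close_tiltedMeans_far_edge` (cgf's `e^{l₀}ε`-close on `|t| ≤ l₀`, `ΔtiltedMean(l₀) ≥ e^{−l₀}(M²∕l₀ − 1)ε`).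
§4 (`log⁺ε′⁻¹ ≤ M·log(1 + 4M∕l₀)` + p517472's `1 + L ≤ (4 + log(1+4∕l₀))·M·log(e + L)`): ★★ `edge_price_two_sided` — for every `0 < l₀`, `ε₀ > 0` two
laws on `[0, 1]` and `0 < ε ≤ ε₀` with cgf's `ε`-close on `|t| ≤ l₀` and `c(l₀)·P₂(ε) ≤ ΔtiltedMean(l₀) ≤ C(l₀)·P₂(ε)`, `P₂(ε) = ε·(1 + log⁺ε⁻¹)²∕log²(e + log⁺ε⁻¹)`,
`c(l₀) = e^{−2l₀}∕(2l₀(4 + log(1+4∕l₀))²)`, `C(l₀) = 256e^{2+2(2e−1)l₀}∕l₀` (upper half: `…N19TiltedPrice.abs_tiltedMean_sub_le_edge_of_cgf_close` at `s = l₀`,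
its `log⁺(2ε)⁻¹` traded by §1's `log_exp_one_add_posLog_le_two_mul`).  The DEGREE CURRENCY is now typed two-sided at the centre (`n`), at the edge (`n²`)
and off the window (`T_n`); inside, Bernstein's `n∕√(1−x²)` from above only.

KERNEL-CHECKED (0 `def`, 0 `sorry`): §1 [folklore] `sum_coeff_mul_mul_pow_eq`, `derivative_chebAff_eval_one_add`, `log_exp_one_add_posLog_le_two_mul` · §2 ★
`exists_expsum_witness_edge` · §3 `integral_id_tilted_le_one`, ★ `exists_cgf_close_tiltedMeans_far_edge` · §4 ★★ `edge_price_two_sided`.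
NOT claimed: the interior two-sided (Bernstein) statement; optimal constants.

HONEST FRAMING (binding).  Elementary; NO consumer in the DAG today; value = optimality certificate of `…N19TiltedPrice`'s edge price.  Nothing of
[Balaban1987RG1]–[Balaban1989LargeFieldII] or [King1986] is asserted, quoted or instantiated; NE7 ∕ NE7b ∕ NE7c NOT PRINTED, NOT proved; N19 NOT discharged;
Track A count unmoved (typed 28∕28 · discharged 5∕27 · A 5∕28).  One finite `T⁴` programme at fixed `ε`; nothing continuum ∕ `ℝ⁴` ∕ OS ∕ mass-gap ∕ Clay.
THEOREMS ONLY; standard axioms; no cite tags.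
-/

set_option autoImplicit false

noncomputable section

open Polynomial Real Finset MeasureTheory ProbabilityTheory

namespace Summit.QuantumFields.YangMills.Theorems.BalabanUVNodesN19TiltedPriceTwoSided

open Summit.QuantumFields.YangMills.Theorems.BalabanUVNodesN19NoLinearPriceWitness
open Summit.QuantumFields.YangMills.Theorems.BalabanUVNodesN19NoLinearPrice
  (expsum_eq_eval abs_expm1_ratio_le_one exists_lawPair_of_weights exp_neg_le_mgf_of_Icc ae_abs_le_one_of_Icc abs_log_sub_log_le)
open Summit.QuantumFields.YangMills.Theorems.BalabanUVNodesN19OffWindowPriceTwoSided (mgf_le_exp_of_Icc)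
open Summit.QuantumFields.YangMills.Theorems.BalabanUVNodesN19SharpPriceTwoSided (one_add_le_mul_log_of_le)
open Summit.QuantumFields.YangMills.Theorems.BalabanUVNodesN19TiltedPrice (abs_tiltedMean_sub_le_edge_of_cgf_close)
open Summit.QuantumFields.BalabanUV.T4Continuum.NE1p.DressedMGFForm (tiltedMean)

/-! ## §1 The first `u`-moment of a coefficient vector, the transported Chebyshev derivative at the edge, and a `log` trade [folklore] -/

/-- `Σ_j [uʲ]p · j · uʲ = u·p′(u)`. [folklore] -/
theorem sum_coeff_mul_mul_pow_eq (p : ℝ[X]) {D : ℕ} (hp : p.natDegree < D) (u : ℝ) :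
    ∑ j ∈ range D, p.coeff j * j * u ^ j = u * p.derivative.eval u := by
  rw [derivative_eval, sum_over_range' _ _ _ hp, mul_sum]
  · refine sum_congr rfl fun j _ => ?_
    rcases j with _ | j
    · simp
    · rw [Nat.add_sub_cancel, pow_succ]
      push_cast
      ring
  · intro j
    rw [zero_mul, zero_mul]

/-- THE TRANSPORTED CHEBYSHEV DERIVATIVE AT THE EDGE: `P_M′(1 + r) = T_M′(1)∕r = M²∕r` (`T_M′ = M·U_{M−1}`, `U_{M−1}(1) = M` — Markov's extremal
value). [folklore] -/
theorem derivative_chebAff_eval_one_add {r : ℝ} (hr : r ≠ 0) (M : ℕ) :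
    (derivative ((Chebyshev.T ℝ M).comp (C r⁻¹ * (X - C 1)))).eval (1 + r) = (M : ℝ) ^ 2 / r := by
  have hdq : derivative (C r⁻¹ * (X - C 1) : ℝ[X]) = C r⁻¹ := by
    rw [derivative_C_mul, derivative_sub, derivative_X, derivative_C, sub_zero, mul_one]
  rw [derivative_comp, hdq, eval_mul, eval_C, eval_comp, Chebyshev.T_derivative_eq_U]
  simp only [eval_mul, eval_C, eval_sub, eval_X, eval_natCast, Int.cast_natCast, add_sub_cancel_left, inv_mul_cancel₀ hr,
    Chebyshev.U_eval_one]
  push_cast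
  field_simp
  ring

/-- `log(e + log⁺ε⁻¹) ≤ 2·log(e + log⁺(2ε)⁻¹)` (`log⁺ε⁻¹ ≤ log 2 + log⁺(2ε)⁻¹ ≤ 1 + log⁺(2ε)⁻¹` and `e + 1 + x ≤ (e + x)²`). [folklore] -/
theorem log_exp_one_add_posLog_le_two_mul {ε : ℝ} (hε : 0 < ε) :
    Real.log (Real.exp 1 + Real.posLog ε⁻¹) ≤ 2 * Real.log (Real.exp 1 + Real.posLog (2 * ε)⁻¹) := by
  set x := Real.posLog (2 * ε)⁻¹ with hx
  have hx0 : 0 ≤ x := Real.posLog_nonneg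
  have he : 2 ≤ Real.exp 1 := by linarith [Real.add_one_le_exp (1 : ℝ)]
  have h2 : Real.posLog (2 : ℝ) ≤ 1 := by
    rw [Real.posLog_eq_log (by norm_num)]
    exact (Real.log_le_sub_one_of_pos two_pos).trans (by norm_num)
  have hL : Real.posLog ε⁻¹ ≤ 1 + x := by
    rw [show ε⁻¹ = 2 * (2 * ε)⁻¹ by field_simp]
    exact Real.posLog_mul.trans (add_le_add h2 le_rfl)
  rw [show (2 : ℝ) * Real.log (Real.exp 1 + x) = Real.log ((Real.exp 1 + x) ^ 2) by rw [Real.log_pow]; norm_num]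
  have hL0 : 0 ≤ Real.posLog ε⁻¹ := Real.posLog_nonneg
  exact Real.log_le_log (by positivity) (by nlinarith)

/-! ## §2 The grid-Chebyshev weights, read AT THE EDGE -/

/-- **THE WITNESS AT THE EDGE.**  For `0 < l₀` and odd `M`: weights `w_0, …, w_M` with `Σ w_j = 0`, `Σ |w_j| = 2` and an `ε` with
`2(1 + 4M∕l₀)^{−M} ≤ ε ≤ 4(l₀e^{l₀}∕(2M))^M` such that `|Σ_j w_j e^{tj∕M}| ≤ ε` on `|t| ≤ l₀`, `Σ_j w_j e^{l₀j∕M} = ε`, and AT THE EDGE the `t`-derivative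
is large: `ε·M²∕l₀ ≤ Σ_j w_j·(j∕M)·e^{l₀j∕M}` — p510514's construction plus §1 (`(ε∕M)(1+r)P_M′(1+r) = εM(1+r)∕r`, `(1+r)∕r ≥ M∕l₀`). [folklore] -/
theorem exists_expsum_witness_edge {l₀ : ℝ} (hl₀ : 0 < l₀) {M : ℕ} (hM : Odd M) :
    ∃ (w : ℕ → ℝ) (ε : ℝ), 0 < ε ∧
      ∑ j ∈ range (M + 1), w j = 0 ∧ ∑ j ∈ range (M + 1), |w j| = 2 ∧
      2 / (1 + 4 * M / l₀) ^ M ≤ ε ∧ ε ≤ 4 * (l₀ * exp l₀ / (2 * M)) ^ M ∧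
      (∀ t : ℝ, |t| ≤ l₀ → |∑ j ∈ range (M + 1), w j * exp (t * j / M)| ≤ ε) ∧
      ∑ j ∈ range (M + 1), w j * exp (l₀ * j / M) = ε ∧
      (M : ℝ) ^ 2 / l₀ * ε ≤ ∑ j ∈ range (M + 1), w j * (j / M) * exp (l₀ * j / M) := by
  have hM0 : 0 < M := hM.pos
  have hMr : (0 : ℝ) < M := Nat.cast_pos.mpr hM0
  have hM1 : (1 : ℝ) ≤ M := by exact_mod_cast hM0
  have ha0 : 0 < l₀ / M := div_pos hl₀ hMr
  set r : ℝ := exp (l₀ / M) - 1 with hr_def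
  have hra : l₀ / M ≤ r := by rw [hr_def]; linarith [Real.add_one_le_exp (l₀ / M)]
  have hr0 : 0 < r := ha0.trans_le hra
  have hal : l₀ / M ≤ l₀ := div_le_self hl₀.le hM1
  have hr_mul : r ≤ l₀ / M * exp (l₀ / M) := Literature.Analysis.ODE.exp_sub_one_le_mul_exp _
  have hr_le : r ≤ l₀ * exp l₀ / M := by
    calc r ≤ l₀ / M * exp (l₀ / M) := hr_mul
      _ ≤ l₀ / M * exp l₀ := mul_le_mul_of_nonneg_left (exp_le_exp.mpr hal) ha0.le
      _ = l₀ * exp l₀ / M := by ring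
  set P : ℝ[X] := (Chebyshev.T ℝ M).comp (C r⁻¹ * (X - C 1)) with hP
  have hPdeg : P.natDegree < M + 1 := by
    rw [hP, natDegree_chebAff hr0.ne']
    exact Nat.lt_succ_self M
  set Λ : ℝ := ∑ j ∈ range (M + 1), |P.coeff j| with hΛ
  have hΛlo : 2 ^ (M - 1) * r⁻¹ ^ M ≤ Λ := pow_le_sum_abs_coeff_chebAff hr0 M
  have hΛhi : Λ ≤ (1 + 4 / r) ^ M := sum_abs_coeff_chebAff_le hr0 M M le_rfl
  have hlead : 0 < (2 : ℝ) ^ (M - 1) * r⁻¹ ^ M := by positivity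
  have hΛ0 : 0 < Λ := lt_of_lt_of_le hlead hΛlo
  have hc0 : 0 < 2 / Λ := by positivity
  have hsum : ∀ g : ℕ → ℝ, ∑ j ∈ range (M + 1), 2 / Λ * P.coeff j * g j =
      2 / Λ * ∑ j ∈ range (M + 1), P.coeff j * g j := fun g => by
    rw [mul_sum]; exact sum_congr rfl fun j _ => mul_assoc _ _ _
  have hexp1 : exp (l₀ / M) = 1 + r := by rw [hr_def]; ring
  refine ⟨fun j => 2 / Λ * P.coeff j, 2 / Λ, hc0, ?_, ?_, ?_, ?_, ?_, ?_, ?_⟩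
  · -- equal mass
    rw [← mul_sum, hP, sum_coeff_chebAff_eq_zero hr0.ne' hM, mul_zero]
  · -- total variation `2`
    have : ∀ j, |2 / Λ * P.coeff j| = 2 / Λ * |P.coeff j| := fun j => by
      rw [abs_mul, abs_of_pos hc0]
    simp_rw [this]
    rw [← mul_sum, ← hΛ, div_mul_cancel₀ _ hΛ0.ne']
  · -- `ε` from below
    rw [div_le_div_iff_of_pos_left two_pos (by positivity) hΛ0]
    refine hΛhi.trans (pow_le_pow_left₀ (by positivity) ?_ M)
    have h4 : 4 / r ≤ 4 * M / l₀ := by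
      rw [mul_div_assoc, div_eq_mul_inv 4 r]
      refine mul_le_mul_of_nonneg_left ?_ (by norm_num)
      calc r⁻¹ ≤ (l₀ / M)⁻¹ := by rw [inv_le_inv₀ hr0 ha0]; exact hra
        _ = M / l₀ := by rw [inv_div]
    linarith
  · -- `ε` from above
    calc 2 / Λ ≤ 2 / (2 ^ (M - 1) * r⁻¹ ^ M) := div_le_div_of_nonneg_left zero_le_two hlead hΛlo
      _ = 4 * (r / 2) ^ M := by
          obtain ⟨k, rfl⟩ := Nat.exists_eq_add_of_le' hM0
          rw [Nat.add_sub_cancel, div_pow, inv_pow, pow_succ (2 : ℝ) k]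
          field_simp
          ring
      _ ≤ 4 * (l₀ * exp l₀ / (2 * M)) ^ M := by
          gcongr 4 * ?_ ^ M
          calc r / 2 ≤ l₀ * exp l₀ / M / 2 := by gcongr
            _ = l₀ * exp l₀ / (2 * M) := by ring
  · -- the window bound
    intro t ht
    rw [hsum, expsum_eq_eval P hPdeg M t, abs_mul, abs_of_pos hc0]
    refine mul_le_of_le_one_right hc0.le ?_
    rw [hP]
    exact abs_eval_chebAff_le_one r M (by rw [hr_def]; exact abs_expm1_ratio_le_one hl₀ hM0 ht)
  · -- attained at `t = l₀`
    rw [hsum, expsum_eq_eval P hPdeg M l₀, hexp1, hP, eval_chebAff_one_add hr0.ne', mul_one]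
  · -- the derivative at the edge: `(ε/M)·(1+r)·P′(1+r) = ε·M·(1+r)/r ≥ ε·M²/l₀`
    have hmom : ∑ j ∈ range (M + 1), 2 / Λ * P.coeff j * ((j : ℝ) / M) * exp (l₀ * j / M) =
        2 / Λ / M * ∑ j ∈ range (M + 1), P.coeff j * j * exp (l₀ / M) ^ j := by
      rw [mul_sum]
      refine sum_congr rfl fun j _ => ?_
      rw [← Real.exp_nat_mul, show (j : ℝ) * (l₀ / M) = l₀ * j / M by ring]
      field_simp
    rw [hmom, sum_coeff_mul_mul_pow_eq P hPdeg, hexp1, hP, derivative_chebAff_eval_one_add hr0.ne']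
    have hkey : (M : ℝ) / l₀ ≤ (1 + r) / r := by
      rw [div_le_div_iff₀ hl₀ hr0]
      have h := mul_le_mul_of_nonneg_left hr_mul hMr.le
      rw [hexp1, show (M : ℝ) * (l₀ / M * (1 + r)) = l₀ * (1 + r) by field_simp] at h
      linarith
    calc (M : ℝ) ^ 2 / l₀ * (2 / Λ) = 2 / Λ / M * (M ^ 2 * (M / l₀)) := by field_simp
      _ ≤ 2 / Λ / M * (M ^ 2 * ((1 + r) / r)) := by gcongr
      _ = 2 / Λ / M * ((1 + r) * ((M : ℝ) ^ 2 / r)) := by ring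

/-! ## §3 Two probability laws on `[0, 1]`: cgf's close on the window, tilted means far AT THE EDGE -/

/-- The mean of a probability law on `[0, 1]` under any of its (absolutely continuous) tilts is at most `1`. [folklore] -/
theorem integral_id_tilted_le_one {μ : Measure ℝ} [IsProbabilityMeasure μ] (hμ : μ (Set.Icc 0 1)ᶜ = 0) (f : ℝ → ℝ)
    [IsProbabilityMeasure (μ.tilted f)] : ∫ x, x ∂(μ.tilted f) ≤ 1 := by
  have hae : ∀ᵐ x ∂(μ.tilted f), |id x| ≤ (1 : ℝ) := (tilted_absolutelyContinuous μ f).ae_le (ae_abs_le_one_of_Icc hμ)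
  have hint : Integrable (fun x : ℝ => x) (μ.tilted f) :=
    ⟨aestronglyMeasurable_id, HasFiniteIntegral.of_bounded (C := 1) (hae.mono fun x hx => by simpa using hx)⟩
  calc ∫ x, x ∂(μ.tilted f) ≤ ∫ _, (1 : ℝ) ∂(μ.tilted f) :=
        integral_mono_ae hint (integrable_const _) (hae.mono fun x hx => (le_abs_self x).trans hx)
    _ = 1 := by simp

/-- **CGF's `e^{l₀}ε`-CLOSE ON THE WINDOW, TILTED MEANS `e^{−l₀}(M²∕l₀ − 1)·ε` APART AT ITS EDGE** (`0 < l₀`, `M` odd, `l₀ ≤ M²`; two probability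
laws on `[0, 1]`, `2(1 + 4M∕l₀)^{−M} ≤ ε ≤ 4(l₀e^{l₀}∕(2M))^M`) — §2's weights through p510514's `exists_lawPair_of_weights`: the partition functions
`Z = mgf(l₀)` differ by exactly `ε`, the tilted first moments `A = ∫x e^{l₀x}` by `D ≥ ε·M²∕l₀`, and `Z_ν·ΔtiltedMean = D − ε·(A_μ∕Z_μ) ≥ D − ε`. [folklore] -/
theorem exists_cgf_close_tiltedMeans_far_edge {l₀ : ℝ} (hl₀ : 0 < l₀) {M : ℕ} (hM : Odd M) (hMl : l₀ ≤ (M : ℝ) ^ 2) :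
    ∃ μ ν : Measure ℝ, IsProbabilityMeasure μ ∧ IsProbabilityMeasure ν ∧
      μ (Set.Icc 0 1)ᶜ = 0 ∧ ν (Set.Icc 0 1)ᶜ = 0 ∧
      ∃ ε : ℝ, 0 < ε ∧ 2 / (1 + 4 * M / l₀) ^ M ≤ ε ∧ ε ≤ 4 * (l₀ * exp l₀ / (2 * M)) ^ M ∧
        (∀ t : ℝ, |t| ≤ l₀ → |cgf id ν t - cgf id μ t| ≤ exp l₀ * ε) ∧
        exp (-l₀) * (((M : ℝ) ^ 2 / l₀ - 1) * ε) ≤ tiltedMean id ν l₀ - tiltedMean id μ l₀ := by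
  obtain ⟨w, ε, hε, h0, h2, hlo, hhi, hwin, hedge, hder⟩ := exists_expsum_witness_edge hl₀ hM
  obtain ⟨μ, ν, iμ, iν, hμ, hν, hg⟩ := exists_lawPair_of_weights w h0 h2
  have hmgf : ∀ t : ℝ, mgf id ν t - mgf id μ t = ∑ j ∈ range (M + 1), w j * exp (t * j / M) := by
    intro t
    simp only [mgf, id]
    rw [hg fun x => exp (t * x)]
    exact sum_congr rfl fun j _ => by rw [mul_div_assoc]
  refine ⟨μ, ν, iμ, iν, hμ, hν, ε, hε, hlo, hhi, fun t ht => ?_, ?_⟩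
  · have hm : 0 < exp (-l₀) := exp_pos _
    calc |cgf id ν t - cgf id μ t| ≤ |mgf id ν t - mgf id μ t| / exp (-l₀) :=
          abs_log_sub_log_le hm (exp_neg_le_mgf_of_Icc hν ht) (exp_neg_le_mgf_of_Icc hμ ht)
      _ ≤ ε / exp (-l₀) := div_le_div_of_nonneg_right (by rw [hmgf]; exact hwin t ht) hm.le
      _ = exp l₀ * ε := by rw [Real.exp_neg, div_inv_eq_mul, mul_comm]
  · -- partition functions and tilted first moments at the edge
    have hintμ : Integrable (fun x : ℝ => exp (l₀ * x)) μ :=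
      Literature.MathematicalPhysics.QuantumFieldTheory.Balaban1983to89.T4GenFunBounds.integrable_exp_mul_of_bound
        aemeasurable_id (ae_abs_le_one_of_Icc hμ) l₀
    have hintν : Integrable (fun x : ℝ => exp (l₀ * x)) ν :=
      Literature.MathematicalPhysics.QuantumFieldTheory.Balaban1983to89.T4GenFunBounds.integrable_exp_mul_of_bound
        aemeasurable_id (ae_abs_le_one_of_Icc hν) l₀
    haveI : IsProbabilityMeasure (μ.tilted fun x : ℝ => l₀ * x) := isProbabilityMeasure_tilted hintμ
    haveI : IsProbabilityMeasure (ν.tilted fun x : ℝ => l₀ * x) := isProbabilityMeasure_tilted hintν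
    set Zμ : ℝ := ∫ x, exp (l₀ * x) ∂μ with hZμ
    set Zν : ℝ := ∫ x, exp (l₀ * x) ∂ν with hZν
    set Aμ : ℝ := ∫ x, exp (l₀ * x) * x ∂μ with hAμ
    set Aν : ℝ := ∫ x, exp (l₀ * x) * x ∂ν with hAν
    have hZμ_eq : Zμ = mgf id μ l₀ := by simp [hZμ, mgf]
    have hZν_eq : Zν = mgf id ν l₀ := by simp [hZν, mgf]
    have hl₀' : |l₀| ≤ l₀ := (abs_of_pos hl₀).le
    have hZμ1 : 0 < Zμ := by rw [hZμ_eq]; exact (exp_pos _).trans_le (exp_neg_le_mgf_of_Icc hμ hl₀')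
    have hZν0 : 0 < Zν := by rw [hZν_eq]; exact (exp_pos _).trans_le (exp_neg_le_mgf_of_Icc hν hl₀')
    have hZνe : Zν ≤ exp l₀ := by rw [hZν_eq]; exact mgf_le_exp_of_Icc hν hl₀.le
    have htm : ∀ (ρ : Measure ℝ), tiltedMean id ρ l₀ = (∫ x, exp (l₀ * x) * x ∂ρ) / ∫ x, exp (l₀ * x) ∂ρ := by
      intro ρ
      simp only [tiltedMean, id, integral_tilted, smul_eq_mul]
      rw [← integral_div]
      exact integral_congr_ae (ae_of_all _ fun x => by ring)
    have htμ : tiltedMean id μ l₀ = Aμ / Zμ := htm μ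
    have htν : tiltedMean id ν l₀ = Aν / Zν := htm ν
    have hZ : Zν - Zμ = ε := by
      rw [hZν, hZμ, hg fun x => exp (l₀ * x), ← hedge]
      exact sum_congr rfl fun j _ => by rw [mul_div_assoc]
    have hA : (M : ℝ) ^ 2 / l₀ * ε ≤ Aν - Aμ := by
      rw [hAν, hAμ, hg fun x => exp (l₀ * x) * x]
      refine hder.trans (le_of_eq (sum_congr rfl fun j _ => ?_))
      rw [mul_div_assoc]; ring
    have htμ1 : Aμ / Zμ ≤ 1 := by
      rw [← htμ, show tiltedMean id μ l₀ = ∫ x, x ∂(μ.tilted fun x : ℝ => l₀ * x) from rfl]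
      exact integral_id_tilted_le_one hμ _
    have hΔ : Zν * (Aν / Zν - Aμ / Zμ) = (Aν - Aμ) - ε * (Aμ / Zμ) := by
      have e1 : Zν * (Aν / Zν) = Aν := mul_div_cancel₀ _ hZν0.ne'
      have e2 : Aμ = Zμ * (Aμ / Zμ) := (mul_div_cancel₀ _ hZμ1.ne').symm
      rw [mul_sub, e1, ← hZ]
      nth_rw 2 [e2]
      ring
    have hnum : ((M : ℝ) ^ 2 / l₀ - 1) * ε ≤ Zν * (Aν / Zν - Aμ / Zμ) := by
      rw [hΔ]
      nlinarith [mul_le_mul_of_nonneg_left htμ1 hε.le]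
    have hnn : 0 ≤ ((M : ℝ) ^ 2 / l₀ - 1) * ε :=
      mul_nonneg (by rw [sub_nonneg, le_div_iff₀ hl₀, one_mul]; exact hMl) hε.le
    rw [htν, htμ]
    calc exp (-l₀) * (((M : ℝ) ^ 2 / l₀ - 1) * ε) ≤ Zν⁻¹ * (Zν * (Aν / Zν - Aμ / Zμ)) := by
          refine mul_le_mul ?_ hnum hnn (inv_nonneg.2 hZν0.le)
          rw [Real.exp_neg]
          exact inv_anti₀ hZν0 hZνe
      _ = Aν / Zν - Aμ / Zμ := by rw [← mul_assoc, inv_mul_cancel₀ hZν0.ne', one_mul]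

/-! ## §4 The two-sided statement at the edge -/

/-- **★★ THE EDGE PRICE IS EXACTLY `P₂(ε) = ε·(1 + log⁺ε⁻¹)²∕log²(e + log⁺ε⁻¹)` (two-sided, arbitrarily small `ε`).**  For every window `0 < l₀` and
every `ε₀ > 0`: two probability laws `μ, ν` on `[0, 1]` and `0 < ε ≤ ε₀` with cgf's `ε`-close on `|t| ≤ l₀` and
`c(l₀)·P₂(ε) ≤ tiltedMean id ν l₀ − tiltedMean id μ l₀ ≤ C(l₀)·P₂(ε)`, `c(l₀) = e^{−2l₀}∕(2l₀·(4 + log(1 + 4∕l₀))²)`, `C(l₀) = 256e^{2+2(2e−1)l₀}∕l₀` — lower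
half §3 at a large odd `M` (p517472's `one_add_le_mul_log_of_le`), upper half `…N19TiltedPrice.abs_tiltedMean_sub_le_edge_of_cgf_close` at `s = l₀`,
`B = 1`, `c = 0` (valid for EVERY such pair) + §1's `log` trade.  Markov's `n²` is the truth at the window's edge. [folklore] -/
theorem edge_price_two_sided {l₀ : ℝ} (hl₀ : 0 < l₀) {ε₀ : ℝ} (hε₀ : 0 < ε₀) :
    ∃ μ ν : Measure ℝ, IsProbabilityMeasure μ ∧ IsProbabilityMeasure ν ∧
      μ (Set.Icc 0 1)ᶜ = 0 ∧ ν (Set.Icc 0 1)ᶜ = 0 ∧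
      ∃ ε : ℝ, 0 < ε ∧ ε ≤ ε₀ ∧ (∀ t : ℝ, |t| ≤ l₀ → |cgf id ν t - cgf id μ t| ≤ ε) ∧
        Real.exp (-2 * l₀) / (2 * l₀ * (4 + Real.log (1 + 4 / l₀)) ^ 2) *
            (ε * (1 + Real.posLog ε⁻¹) ^ 2 / Real.log (Real.exp 1 + Real.posLog ε⁻¹) ^ 2) ≤
          tiltedMean id ν l₀ - tiltedMean id μ l₀ ∧
        tiltedMean id ν l₀ - tiltedMean id μ l₀ ≤
          256 * Real.exp (2 + 2 * (2 * Real.exp 1 - 1) * l₀) / l₀ *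
            (ε * (1 + Real.posLog ε⁻¹) ^ 2 / Real.log (Real.exp 1 + Real.posLog ε⁻¹) ^ 2) := by
  set a : ℝ := l₀ * Real.exp l₀ with ha
  have ha0 : 0 < a := by positivity
  obtain ⟨k, hk⟩ := exists_nat_gt (max (max a (2 * a * Real.exp l₀ / ε₀)) (2 * l₀))
  have hka : a < k := ((le_max_left _ _).trans (le_max_left _ _)).trans_lt hk
  have hkε : 2 * a * Real.exp l₀ / ε₀ < k := ((le_max_right _ _).trans (le_max_left _ _)).trans_lt hk
  have hk0 : (0 : ℝ) < k := ha0.trans hka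
  set M : ℕ := 2 * k + 1 with hMdef
  have hModd : Odd M := odd_two_mul_add_one k
  have hMk : (k : ℝ) < M := by rw [hMdef]; push_cast; linarith
  have hM0 : (0 : ℝ) < M := hk0.trans hMk
  have hM1 : (1 : ℝ) ≤ M := by exact_mod_cast hModd.pos
  have hM2l : 2 * l₀ ≤ (M : ℝ) ^ 2 := by nlinarith [(le_max_right _ _).trans_lt hk]
  obtain ⟨μ, ν, iμ, iν, hμ, hν, ε, hε, hlo, hhi, hwin, hlow⟩ :=
    exists_cgf_close_tiltedMeans_far_edge hl₀ hModd (by linarith)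
  set ε' : ℝ := Real.exp l₀ * ε with hε'
  have hε'0 : 0 < ε' := by positivity
  have hb0 : 0 ≤ a / (2 * M) := div_nonneg ha0.le (by positivity)
  have hb1 : a / (2 * M) ≤ 1 := by rw [div_le_one (by positivity)]; linarith
  have hεsmall : ε' ≤ ε₀ := by
    have h1 : (a / (2 * M)) ^ M ≤ a / (2 * M) :=
      (pow_le_pow_of_le_one hb0 hb1 (by exact_mod_cast hModd.pos)).trans (pow_one _).le
    have h2 : ε' ≤ 2 * a * Real.exp l₀ / M :=
      calc ε' ≤ Real.exp l₀ * (4 * (a / (2 * M)) ^ M) := by rw [hε', ha]; gcongr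
        _ ≤ Real.exp l₀ * (4 * (a / (2 * M))) := by gcongr
        _ = 2 * a * Real.exp l₀ / M := by field_simp; ring
    have h3 : 2 * a * Real.exp l₀ / M ≤ 2 * a * Real.exp l₀ / k :=
      div_le_div_of_nonneg_left (mul_pos (mul_pos two_pos ha0) (Real.exp_pos _)).le hk0 hMk.le
    have h4 : 2 * a * Real.exp l₀ / k < ε₀ := by
      rw [div_lt_iff₀ hk0]
      have := (div_lt_iff₀ hε₀).1 hkε
      linarith
    linarith
  refine ⟨μ, ν, iμ, iν, hμ, hν, ε', hε'0, hεsmall, hwin, ?_, ?_⟩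
  · -- LOWER: `log⁺ε′⁻¹ ≤ M·log(1 + 4M/l₀)` and p517472's arithmetic, squared
    set L := Real.posLog ε'⁻¹ with hL
    have hL0 : 0 ≤ L := Real.posLog_nonneg
    have hbase : 1 ≤ 1 + 4 * (M : ℝ) / l₀ := by linarith [show 0 ≤ 4 * (M : ℝ) / l₀ by positivity]
    have hpow1 : 1 ≤ (1 + 4 * (M : ℝ) / l₀) ^ M := one_le_pow₀ hbase
    have hinv : ε'⁻¹ ≤ (1 + 4 * (M : ℝ) / l₀) ^ M := by
      rw [inv_le_comm₀ hε'0 (by positivity)]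
      calc ((1 + 4 * (M : ℝ) / l₀) ^ M)⁻¹ = 1 * (1 / (1 + 4 * (M : ℝ) / l₀) ^ M) := by rw [one_mul, one_div]
        _ ≤ Real.exp l₀ * (2 / (1 + 4 * (M : ℝ) / l₀) ^ M) := by
            gcongr
            · exact Real.one_le_exp hl₀.le
            · norm_num
        _ ≤ ε' := by rw [hε']; gcongr
    have hLle : L ≤ M * Real.log (1 + 4 * M / l₀) := by
      calc L = Real.posLog ε'⁻¹ := hL
        _ ≤ Real.posLog ((1 + 4 * (M : ℝ) / l₀) ^ M) :=
            Real.monotoneOn_posLog (Set.mem_Ici.2 (inv_nonneg.2 hε'0.le)) (Set.mem_Ici.2 (by positivity)) hinv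
        _ = Real.log ((1 + 4 * (M : ℝ) / l₀) ^ M) := Real.posLog_eq_log (by rwa [abs_of_nonneg (by positivity)])
        _ = M * Real.log (1 + 4 * M / l₀) := by rw [Real.log_pow]
    have harith := one_add_le_mul_log_of_le hl₀ hModd.pos hL0 hLle
    have hc : 0 < 4 + Real.log (1 + 4 / l₀) := by linarith [Real.log_nonneg (show (1:ℝ) ≤ 1 + 4 / l₀ by linarith [div_pos four_pos hl₀])]
    have hlogpos : 0 < Real.log (Real.exp 1 + L) := Real.log_pos (by linarith [Real.add_one_le_exp (1 : ℝ)])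
    have hhalf : (M : ℝ) ^ 2 / (2 * l₀) * ε ≤ ((M : ℝ) ^ 2 / l₀ - 1) * ε := by
      refine mul_le_mul_of_nonneg_right ?_ hε.le
      have e : (M : ℝ) ^ 2 / l₀ = 2 * ((M : ℝ) ^ 2 / (2 * l₀)) := by field_simp
      have h1 : 1 ≤ (M : ℝ) ^ 2 / (2 * l₀) := by rw [le_div_iff₀ (by positivity), one_mul]; exact hM2l
      linarith
    generalize hcdef : 4 + Real.log (1 + 4 / l₀) = c at hc harith
    generalize hgdef : Real.log (Real.exp 1 + L) = g at hlogpos harith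
    have h1L : 0 ≤ 1 + L := by linarith
    have hsq : (1 + L) ^ 2 ≤ (c * M * g) ^ 2 := pow_le_pow_left₀ h1L harith 2
    calc Real.exp (-2 * l₀) / (2 * l₀ * c ^ 2) * (ε' * (1 + L) ^ 2 / g ^ 2)
        ≤ Real.exp (-2 * l₀) / (2 * l₀ * c ^ 2) * (ε' * (c * M * g) ^ 2 / g ^ 2) := by gcongr
      _ = Real.exp (-l₀) * ((M : ℝ) ^ 2 / (2 * l₀) * ε) := by
          rw [hε', show (-2 : ℝ) * l₀ = -l₀ + -l₀ by ring, Real.exp_add, Real.exp_neg l₀]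
          field_simp
      _ ≤ Real.exp (-l₀) * (((M : ℝ) ^ 2 / l₀ - 1) * ε) := mul_le_mul_of_nonneg_left hhalf (Real.exp_pos _).le
      _ ≤ _ := hlow
  · -- UPPER: `…N19TiltedPrice` at `s = l₀`, `B = 1`, `c = 0`, then `log⁺(2ε′)⁻¹ ≤ log⁺ε′⁻¹` and §1's `log` trade
    have hwin0 : ∀ u : ℝ, |u| ≤ l₀ → |cgf id ν u - cgf id μ u - 0| ≤ ε' := fun u hu => by rw [sub_zero]; exact hwin u hu
    have hup := abs_tiltedMean_sub_le_edge_of_cgf_close (ν := μ) (ν' := ν) (F := id) (F' := id) (B := 1) aemeasurable_id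
      (ae_abs_le_one_of_Icc hμ) aemeasurable_id (ae_abs_le_one_of_Icc hν) hl₀ hε'0.le hwin0 (le_of_eq (abs_of_pos hl₀))
    refine (le_abs_self _).trans (hup.trans ?_)
    set L := Real.posLog ε'⁻¹ with hL
    set L₂ := Real.posLog (2 * ε')⁻¹ with hL₂
    have hL0 : 0 ≤ L := Real.posLog_nonneg
    have hL₂0 : 0 ≤ L₂ := Real.posLog_nonneg
    have hL₂L : L₂ ≤ L :=
      Real.monotoneOn_posLog (Set.mem_Ici.2 (by positivity)) (Set.mem_Ici.2 (by positivity)) (inv_anti₀ hε'0 (by linarith))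
    have hg₂ : 0 < Real.log (Real.exp 1 + L₂) :=
      Real.log_pos (by linarith [Real.add_one_le_exp (1 : ℝ)])
    have htrade : Real.log (Real.exp 1 + L) ≤ 2 * Real.log (Real.exp 1 + L₂) := log_exp_one_add_posLog_le_two_mul hε'0
    have hg : 0 < Real.log (Real.exp 1 + L) := Real.log_pos (by linarith [Real.add_one_le_exp (1 : ℝ)])
    rw [abs_of_pos hl₀, mul_one, show l₀ + l₀ = 2 * l₀ by ring]
    have hinvlog : 1 / Real.log (Real.exp 1 + L₂) ^ 2 ≤ 4 / Real.log (Real.exp 1 + L) ^ 2 := by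
      rw [div_le_div_iff₀ (by positivity) (by positivity), one_mul]
      nlinarith [htrade, hg, hg₂]
    calc 64 * Real.exp (2 + (2 * Real.exp 1 - 1) * (2 * l₀)) * ε' * (1 + L₂) ^ 2 / (l₀ * Real.log (Real.exp 1 + L₂) ^ 2)
        = 64 * Real.exp (2 + 2 * (2 * Real.exp 1 - 1) * l₀) / l₀ * (ε' * (1 + L₂) ^ 2) * (1 / Real.log (Real.exp 1 + L₂) ^ 2) := by
          rw [show (2 * Real.exp 1 - 1) * (2 * l₀) = 2 * (2 * Real.exp 1 - 1) * l₀ by ring]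
          field_simp
      _ ≤ 64 * Real.exp (2 + 2 * (2 * Real.exp 1 - 1) * l₀) / l₀ * (ε' * (1 + L) ^ 2) * (4 / Real.log (Real.exp 1 + L) ^ 2) := by
          gcongr
      _ = 256 * Real.exp (2 + 2 * (2 * Real.exp 1 - 1) * l₀) / l₀ * (ε' * (1 + L) ^ 2 / Real.log (Real.exp 1 + L) ^ 2) := by
          field_simp
          ring

end Summit.QuantumFields.YangMills.Theorems.BalabanUVNodesN19TiltedPriceTwoSided

end
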